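import Summits.NavierStokesRegularity.FluidComputer.CollapseAnsatzVorticityObstruction
import Summits.NavierStokesRegularity.FluidComputer.DesignedBlowupRegularity
import Literature.Analysis.FluidPDE.TaoFiniteEnergyLerayHopf
import HarnessLib

/-!
# A designed forced blow-up is never an exact collapse ansatz near its blow-up time (`γ ≠ ½`)

Cell `ns-blowup`, seat `ns-blowup-ecbridge-2` (g4; the E–C endpoint theory seat). LABEL: E–C typing
(KERNEL, FACT-FREE; theorems only). WHAT THIS IS NOT: not Navier–Stokes evidence — `DesignedBlowup ν`
is a TYPE with no asserted inhabitant; the theorems say what an inhabitant can NOT look like.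
Companion memo: `run/shared/lean/pub/ns-blowup/ecbridge2/ECBRIDGE-2-MEMO-3.md` §1 (E).

## Content (the collapse obstruction read on the generic E–C object)

`CollapseAnsatzVorticityObstruction.lean` (this seat, g4): if the residual of the EXACT collapse
ansatz `u = (T−t)^{γ−1} U(x/(T−t)^γ)` (`γ ≠ ½`, `γ > −½`, `ν ≠ 0`, any `C²` pressure) is the
restriction of a Clay-class field, then the vorticity profile is harmonic, and trivial under any
integrability. Here, BY NAME on `DesignedBlowup ν` (`DesignedBlowupClayBridge.lean`):

* `timeDerivWithin_Ico_eq_timeDeriv_of_eqOn` — plumbing: at interior times the one-sided residual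
  of the design (`nsResidual (Ico 0 T)`, `DesignedBlowupResidual.lean`) is the two-sided residual of
  the ansatz it coincides with;
* **`DesignedBlowup.profile_eq_zero_of_eq_selfSimilarCollapse`** — if a designed blow-up's velocity
  COINCIDES on `(t₁, T) × ℝ³` (`0 ≤ t₁ < T`) with an exact collapse ansatz about its own blow-up time,
  `γ ≠ ½`, `γ > −½`, `ν ≠ 0`, with a divergence-free `C³` profile `U` having `curl U ∈ L^p` and
  `U ∈ L^r` (some `1 ≤ p, r < ∞`), then `U ≡ 0` — its Clay force IS the residual
  (`DesignedBlowup.force_eq_nsResidual`), whose curl is bounded;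
* **`DesignedBlowup.velocity_eq_zero_of_eq_selfSimilarCollapse`** — hence the design's velocity
  VANISHES on `(t₁, T) × ℝ³`;
* **`DesignedBlowup.not_unboundedOn_of_eq_selfSimilarCollapse`** — and therefore it is NOT
  unbounded on `[0, T) × K` for any compact `K`: an exact collapse ansatz cannot carry the pointwise
  singularity of an E–C design (the witness of `DesignedBlowup.ofUnboundedOn` /
  `navierStokesBreakdownR3_of_clayResidual` is unavailable for such designs);
* §3 (`ν > 0`): the integrability hypotheses are AUTOMATIC — `memLp_two_profile_of_eq_selfSimilarCollapse`
  (finite slab energy ⇒ `U ∈ L²`, change of variables) and `memLp_two_curl_profile_of_eq_selfSimilarCollapse`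
  (Tao's class on closed sub-slabs, FACT-FREE by `DesignedBlowup.hasBoundedSobolevNormsOn` ⇒ `curl U ∈ L²`),
  whence **`DesignedBlowup.not_unboundedOn_of_eq_selfSimilarCollapse_of_pos`**: for `ν > 0`, `γ ≠ ½`,
  `γ > −½`, NO designed blow-up whose velocity is an exact collapse ansatz with a divergence-free `C³`
  profile on some `(t₁, T) × ℝ³` is unbounded on any `[0, T) × K` — no hypothesis on `U` beyond
  smoothness and incompressibility.

References: P. Constantin, M. Ignatova, V. Vicol, arXiv:2602.17570 (2026), §3.1
[cite: ConstantinIgnatovaVicol2026Putative, §3.1]; C. L. Fefferman, Clay problem description, (C), (5)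
[cite: FeffermanClay2006, (C) (5)].
-/

noncomputable section

namespace Summit.NavierStokesRegularity.FluidComputer

open Set Filter Topology Function InnerProductSpace MeasureTheory
open scoped Laplacian RealInnerProductSpace ENNReal
open Literature.Analysis.FluidPDE

/-! ## §1 Plumbing: one-sided vs two-sided time derivative at interior times -/

/-- At an interior time `t ∈ (t₁, T)`, `0 ≤ t₁`, the one-sided time derivative within `[0, T)` of a
field `u` that COINCIDES with `v` on `(t₁, T) × X` is the two-sided time derivative of `v`
(`derivWithin = deriv` in the interior; derivatives of germs). [folklore] -/
theorem timeDerivWithin_Ico_eq_timeDeriv_of_eqOn {X F : Type*} [NormedAddCommGroup F] [NormedSpace ℝ F]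
    {u v : ℝ → X → F} {t₁ T t : ℝ} (ht₁ : 0 ≤ t₁) (ht : t ∈ Ioo t₁ T)
    (heq : ∀ s ∈ Ioo t₁ T, ∀ x, u s x = v s x) (x : X) :
    timeDerivWithin (Ico 0 T) u t x = timeDeriv v t x := by
  have hnhds : Ioo t₁ T ∈ 𝓝 t := isOpen_Ioo.mem_nhds ht
  have hIco : Ico (0 : ℝ) T ∈ 𝓝 t :=
    Filter.mem_of_superset hnhds fun s hs => ⟨ht₁.trans hs.1.le, hs.2⟩
  rw [timeDerivWithin_apply, timeDeriv_apply, derivWithin_of_mem_nhds hIco]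
  refine Filter.EventuallyEq.deriv_eq ?_
  filter_upwards [hnhds] with s hs
  exact heq s hs x

namespace DesignedBlowup

variable {ν γ t₁ : ℝ} (D : DesignedBlowup ν) {U : EuclideanSpace ℝ (Fin 3) → EuclideanSpace ℝ (Fin 3)}

/-- **The force of a design that coincides with an exact collapse ansatz IS the ansatz's residual**
(with the design's own pressure): on `(t₁, T) × ℝ³`,
`f = ∂ₜu_γ + (u_γ·∇)u_γ − νΔu_γ + ∇p`, `u_γ = selfSimilarCollapse γ T U`. [cite: FeffermanClay2006, (C)] -/
theorem force_eq_residual_selfSimilarCollapse (ht₁ : 0 ≤ t₁)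
    (heq : ∀ t ∈ Ioo t₁ D.T, ∀ x, D.u t x = selfSimilarCollapse γ D.T U t x) :
    ∀ t ∈ Ioo t₁ D.T, ∀ x, D.f t x =
      timeDeriv (selfSimilarCollapse γ D.T U) t x +
        convect (selfSimilarCollapse γ D.T U t) (selfSimilarCollapse γ D.T U t) x -
        ν • (Δ (selfSimilarCollapse γ D.T U t)) x + gradient (D.p t) x := by
  intro t ht x
  have hslice : D.u t = selfSimilarCollapse γ D.T U t := funext fun y => heq t ht y
  rw [D.force_eq_nsResidual t ⟨ht₁.trans ht.1.le, ht.2⟩ x, nsResidual_apply,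
    timeDerivWithin_Ico_eq_timeDeriv_of_eqOn ht₁ ht heq x, hslice]

/-- **A designed blow-up which is an exact collapse ansatz near `T` has a trivial profile.** Let
`D : DesignedBlowup ν`, `ν ≠ 0`, and suppose `D.u = selfSimilarCollapse γ D.T U` on `(t₁, T) × ℝ³`,
`0 ≤ t₁ < T`, with `γ ≠ ½`, `γ > −½`, `U ∈ C³` divergence free, `curl U ∈ L^p` and `U ∈ L^r` for some
`1 ≤ p, r < ∞`. Then `U ≡ 0`: the design's Clay force is the residual of the ansatz with the design's
(smooth) pressure, its curl is bounded, and `CollapseAnsatz.profile_eq_zero` applies. No named fact.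
[cite: FeffermanClay2006, (C) (5)] [cite: ConstantinIgnatovaVicol2026Putative, §3.1] -/
theorem profile_eq_zero_of_eq_selfSimilarCollapse (hν : ν ≠ 0) (hγ : γ ≠ 1 / 2)
    (hγ' : -(1 / 2) < γ) (ht₁ : 0 ≤ t₁) (ht₁T : t₁ < D.T) (hU : ContDiff ℝ 3 U)
    (hdiv : VectorCalculus.IsDivFree U)
    (heq : ∀ t ∈ Ioo t₁ D.T, ∀ x, D.u t x = selfSimilarCollapse γ D.T U t x)
    {p : ℝ≥0∞} (hp1 : 1 ≤ p) (hp : p ≠ ⊤) (hω : MemLp (curl U) p volume)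
    {r : ℝ≥0∞} (hr1 : 1 ≤ r) (hr : r ≠ ⊤) (hUr : MemLp U r volume) : U = 0 := by
  have hq : ∀ t ∈ Ioo t₁ D.T, ContDiff ℝ 2 (D.p t) := fun t ht =>
    (D.classical.contDiff_pressure ⟨ht₁.trans ht.1.le, ht.2⟩).of_le (by norm_cast)
  obtain ⟨M, hM⟩ := CollapseAnsatz.clayForce_curl_bounded D.force_smooth D.force_decay
  have hres := D.force_eq_residual_selfSimilarCollapse ht₁ heq
  refine CollapseAnsatz.profile_eq_zero hγ hγ' hν ht₁T hU hdiv hq (M := M) ?_ hp1 hp hω hr1 hr hUr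
  intro t ht x
  have hfun : (fun z => timeDeriv (selfSimilarCollapse γ D.T U) t z +
      convect (selfSimilarCollapse γ D.T U t) (selfSimilarCollapse γ D.T U t) z -
      ν • (Δ (selfSimilarCollapse γ D.T U t)) z + gradient (D.p t) z) = D.f t :=
    funext fun z => (hres t ht z).symm
  rw [hfun]
  exact hM t (ht₁.trans ht.1.le) x

/-- **… hence its velocity vanishes on `(t₁, T) × ℝ³`.** [cite: FeffermanClay2006, (C)] -/
theorem velocity_eq_zero_of_eq_selfSimilarCollapse (hν : ν ≠ 0) (hγ : γ ≠ 1 / 2)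
    (hγ' : -(1 / 2) < γ) (ht₁ : 0 ≤ t₁) (ht₁T : t₁ < D.T) (hU : ContDiff ℝ 3 U)
    (hdiv : VectorCalculus.IsDivFree U)
    (heq : ∀ t ∈ Ioo t₁ D.T, ∀ x, D.u t x = selfSimilarCollapse γ D.T U t x)
    {p : ℝ≥0∞} (hp1 : 1 ≤ p) (hp : p ≠ ⊤) (hω : MemLp (curl U) p volume)
    {r : ℝ≥0∞} (hr1 : 1 ≤ r) (hr : r ≠ ⊤) (hUr : MemLp U r volume) :
    ∀ t ∈ Ioo t₁ D.T, ∀ x, D.u t x = 0 := by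
  have hU0 := D.profile_eq_zero_of_eq_selfSimilarCollapse hν hγ hγ' ht₁ ht₁T hU hdiv heq hp1 hp hω
    hr1 hr hUr
  intro t ht x
  rw [heq t ht x, hU0, selfSimilarCollapse_zero]
  rfl

/-- **… and therefore it is NOT unbounded on `[0, T) × K` for any compact `K`**: on `[0, t']`,
`t₁ < t' < T`, the design is jointly continuous, hence bounded on the compact box `[0, t'] × K`, and
on `(t₁, T)` it vanishes. An exact collapse ansatz (`γ ≠ ½`) cannot carry the pointwise singularity
of an E–C design. No named fact. [cite: FeffermanClay2006, (C)] -/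
theorem not_unboundedOn_of_eq_selfSimilarCollapse (hν : ν ≠ 0) (hγ : γ ≠ 1 / 2)
    (hγ' : -(1 / 2) < γ) (ht₁ : 0 ≤ t₁) (ht₁T : t₁ < D.T) (hU : ContDiff ℝ 3 U)
    (hdiv : VectorCalculus.IsDivFree U)
    (heq : ∀ t ∈ Ioo t₁ D.T, ∀ x, D.u t x = selfSimilarCollapse γ D.T U t x)
    {p : ℝ≥0∞} (hp1 : 1 ≤ p) (hp : p ≠ ⊤) (hω : MemLp (curl U) p volume)
    {r : ℝ≥0∞} (hr1 : 1 ≤ r) (hr : r ≠ ⊤) (hUr : MemLp U r volume)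
    {K : Set (EuclideanSpace ℝ (Fin 3))} (hK : IsCompact K) :
    ¬ ∀ M : ℝ, ∃ t ∈ Ico 0 D.T, ∃ x ∈ K, M < ‖D.u t x‖ := by
  have hzero := D.velocity_eq_zero_of_eq_selfSimilarCollapse hν hγ hγ' ht₁ ht₁T hU hdiv heq hp1 hp
    hω hr1 hr hUr
  -- a time `t'` strictly between `t₁` and `T`, and the compact box `[0, t'] × K`
  obtain ⟨t', ht₁t', ht'T⟩ := exists_between ht₁T
  set Kb : Set (ℝ × EuclideanSpace ℝ (Fin 3)) := Icc (0 : ℝ) t' ×ˢ K with hKb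
  have hKc : IsCompact Kb := isCompact_Icc.prod hK
  have hsub : Kb ⊆ Ico (0 : ℝ) D.T ×ˢ (univ : Set (EuclideanSpace ℝ (Fin 3))) :=
    prod_mono (fun s hs => ⟨hs.1, lt_of_le_of_lt hs.2 ht'T⟩) (subset_univ _)
  have hcont : ContinuousOn (uncurry D.u) Kb :=
    (ContDiffOn.continuousOn D.classical.smooth_velocity).mono hsub
  obtain ⟨M, hM⟩ := hKc.exists_bound_of_continuousOn hcont
  intro hub
  obtain ⟨t, ht, x, hx, hlt⟩ := hub (max M 0)
  rcases le_or_gt t t' with htt' | htt'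
  · -- inside the box: bounded by `M`
    have hmem : (t, x) ∈ Kb := mk_mem_prod ⟨ht.1, htt'⟩ hx
    have hb := hM _ hmem
    simp only [uncurry_apply_pair] at hb
    exact absurd (hlt.trans_le hb) (not_lt.2 (le_max_left M 0))
  · -- after `t'`: the velocity vanishes
    have h0 := hzero t ⟨ht₁t'.trans htt', ht.2⟩ x
    rw [h0, norm_zero] at hlt
    exact absurd hlt (not_lt.2 (le_max_right M 0))

/-! ## §3 For `ν > 0` the integrability of the profile is automatic -/

/-- Dilation bookkeeping: `‖a • U(c • x)‖² = a² ‖U(c • x)‖²`. [folklore] -/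
private theorem norm_smul_comp_sq (a c : ℝ) (U V : EuclideanSpace ℝ (Fin 3) → EuclideanSpace ℝ (Fin 3))
    (hV : ∀ x, V x = a • U (c • x)) (x : EuclideanSpace ℝ (Fin 3)) :
    ‖V x‖ ^ 2 = a ^ 2 * ‖U (c • x)‖ ^ 2 := by
  rw [hV x, norm_smul, mul_pow, Real.norm_eq_abs, sq_abs]

/-- **`L²` transfers from a dilate to the profile**: if `V = a • U(c ·)` with `a, c ≠ 0`, `U`
continuous and `V ∈ L²(ℝ³)`, then `U ∈ L²(ℝ³)` (Haar change of variables,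
Mathlib `integrable_comp_smul_iff`). [folklore] -/
theorem memLp_two_of_eq_smul_comp_smul {a c : ℝ} (ha : a ≠ 0) (hc : c ≠ 0)
    {U V : EuclideanSpace ℝ (Fin 3) → EuclideanSpace ℝ (Fin 3)} (hU : Continuous U)
    (hV : ∀ x, V x = a • U (c • x)) (hV2 : MemLp V 2 volume) : MemLp U 2 volume := by
  have hVm : AEStronglyMeasurable V volume := hV2.1
  have hint : Integrable (fun x => ‖V x‖ ^ 2) volume := (memLp_two_iff_integrable_sq_norm hVm).1 hV2
  have h1 : Integrable (fun x => ‖U (c • x)‖ ^ 2) volume := by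
    have h := hint.const_mul (a ^ 2)⁻¹
    refine h.congr (Eventually.of_forall fun x => ?_)
    simp only [norm_smul_comp_sq a c U V hV x, ← mul_assoc, inv_mul_cancel₀ (pow_ne_zero 2 ha),
      one_mul]
  have h2 : Integrable (fun y => ‖U y‖ ^ 2) volume :=
    (integrable_comp_smul_iff volume (fun y => ‖U y‖ ^ 2) hc).1 h1
  exact (memLp_two_iff_integrable_sq_norm hU.aestronglyMeasurable).2 h2

variable {T t : ℝ}

/-- **Finite energy of the ansatz slice gives `U ∈ L²`**: if `selfSimilarCollapse γ T U t ∈ L²` for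
one `t < T` and `U` is continuous, then `U ∈ L²`. [cite: ConstantinIgnatovaVicol2026Putative, §3.1 eq. (3.2)] -/
theorem memLp_two_profile_of_selfSimilarCollapse (ht : t < T) (hU : Continuous U)
    (h2 : MemLp (selfSimilarCollapse γ T U t) 2 volume) : MemLp U 2 volume := by
  have hs : 0 < T - t := sub_pos.2 ht
  exact memLp_two_of_eq_smul_comp_smul (Real.rpow_pos_of_pos hs _).ne' (Real.rpow_pos_of_pos hs _).ne'
    hU (fun x => selfSimilarCollapse_apply γ T U t x) h2

/-- **Finite enstrophy of the ansatz slice gives `curl U ∈ L²`**: if `∫ |D(selfSimilarCollapse γ T U t)|² < ∞`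
for one `t < T` and `U ∈ C¹`, then `curl U ∈ L²` (`|curl v| ≤ κ |Dv|`, then the dilation rule for the
curl and the same change of variables). [cite: ConstantinIgnatovaVicol2026Putative, §3.1 eq. (3.2)] -/
theorem memLp_two_curl_profile_of_selfSimilarCollapse (ht : t < T) (hU : ContDiff ℝ 1 U)
    (hD : ∫⁻ x, ‖iteratedFDeriv ℝ 1 (selfSimilarCollapse γ T U t) x‖ₑ ^ 2 < ⊤) :
    MemLp (curl U) 2 volume := by
  have hs : 0 < T - t := sub_pos.2 ht
  set v := selfSimilarCollapse γ T U t with hv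
  -- `curl v ∈ L²`
  have hv1 : ContDiff ℝ 1 v := by
    rw [hv, show selfSimilarCollapse γ T U t = fun x => (T - t) ^ (γ - 1) • U ((T - t) ^ (-γ) • x)
      from rfl]
    exact (hU.comp (contDiff_const_smul _)).const_smul _
  have hcont : Continuous (curl v) := continuous_curl hv1
  have hκ : ∀ x, ‖curl v x‖ₑ ^ 2 ≤ ENNReal.ofReal (‖curlCLM‖ ^ 2) * ‖iteratedFDeriv ℝ 1 v x‖ₑ ^ 2 := by
    intro x
    have h1 : ‖curl v x‖ ≤ ‖curlCLM‖ * ‖iteratedFDeriv ℝ 1 v x‖ := by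
      rw [norm_iteratedFDeriv_one]; exact norm_curl_le v x
    have h0 : 0 ≤ ‖curlCLM‖ * ‖iteratedFDeriv ℝ 1 v x‖ := by positivity
    calc ‖curl v x‖ₑ ^ 2 = ENNReal.ofReal (‖curl v x‖ ^ 2) := by
          rw [← ofReal_norm, ENNReal.ofReal_pow (norm_nonneg _)]
      _ ≤ ENNReal.ofReal ((‖curlCLM‖ * ‖iteratedFDeriv ℝ 1 v x‖) ^ 2) :=
          ENNReal.ofReal_le_ofReal (pow_le_pow_left₀ (norm_nonneg _) h1 2)
      _ = ENNReal.ofReal (‖curlCLM‖ ^ 2) * ‖iteratedFDeriv ℝ 1 v x‖ₑ ^ 2 := by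
          rw [mul_pow, ENNReal.ofReal_mul (sq_nonneg _), ← ofReal_norm (iteratedFDeriv ℝ 1 v x),
            ENNReal.ofReal_pow (norm_nonneg _)]
  have hfin : ∫⁻ x, ‖curl v x‖ₑ ^ 2 < ⊤ := by
    calc ∫⁻ x, ‖curl v x‖ₑ ^ 2 ≤ ∫⁻ x, ENNReal.ofReal (‖curlCLM‖ ^ 2) * ‖iteratedFDeriv ℝ 1 v x‖ₑ ^ 2 :=
          lintegral_mono hκ
      _ = ENNReal.ofReal (‖curlCLM‖ ^ 2) * ∫⁻ x, ‖iteratedFDeriv ℝ 1 v x‖ₑ ^ 2 := by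
          rw [lintegral_const_mul' _ _ ENNReal.ofReal_ne_top]
      _ < ⊤ := ENNReal.mul_lt_top ENNReal.ofReal_lt_top hD
  have hmem : MemLp (curl v) 2 volume := memLp_two_of_lintegral_lt_top hcont hfin
  -- transfer to `curl U` by the dilation rule for the curl
  refine memLp_two_of_eq_smul_comp_smul (a := (T - t) ^ (γ - 1) * (T - t) ^ (-γ))
    (c := (T - t) ^ (-γ)) (mul_ne_zero (Real.rpow_pos_of_pos hs _).ne' (Real.rpow_pos_of_pos hs _).ne')
    (Real.rpow_pos_of_pos hs _).ne' (continuous_curl hU) (fun x => ?_) hmem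
  rw [hv, show selfSimilarCollapse γ T U t = fun x => (T - t) ^ (γ - 1) • U ((T - t) ^ (-γ) • x)
    from rfl, curl_smul_comp_smul]

/-- **For `ν > 0` the integrability is automatic.** A designed blow-up with `ν > 0` whose velocity is
an exact collapse ansatz `selfSimilarCollapse γ T U` on `(t₁, T) × ℝ³` (`0 ≤ t₁ < T`) with a `C³`
profile has `U ∈ L²` (finite slab energy) and `curl U ∈ L²` (Tao's class on closed sub-slabs, FACT-FREE,
`DesignedBlowup.hasBoundedSobolevNormsOn`). [cite: Tao2011, Cor. 11.1] -/
theorem memLp_two_profile_and_curl_of_eq_selfSimilarCollapse (hν : 0 < ν) (ht₁ : 0 ≤ t₁)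
    (ht₁T : t₁ < D.T) (hU : ContDiff ℝ 3 U)
    (heq : ∀ t ∈ Ioo t₁ D.T, ∀ x, D.u t x = selfSimilarCollapse γ D.T U t x) :
    MemLp U 2 volume ∧ MemLp (curl U) 2 volume := by
  -- the slice at the midpoint `t₀ = (t₁ + T)/2`
  set t₀ : ℝ := (t₁ + D.T) / 2 with ht₀
  have ht₀I : t₀ ∈ Ioo t₁ D.T := ⟨by rw [ht₀]; linarith, by rw [ht₀]; linarith⟩
  have ht₀0 : 0 < t₀ := lt_of_le_of_lt ht₁ ht₀I.1
  have hslice : D.u t₀ = selfSimilarCollapse γ D.T U t₀ := funext fun x => heq t₀ ht₀I x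
  have hUc : Continuous U := hU.continuous
  -- energy of the slice
  obtain ⟨C, hCt, hC⟩ := D.energy t₀ ht₀I.2
  have h2 : MemLp (D.u t₀) 2 volume :=
    memLp_two_of_lintegral_lt_top (D.classical.contDiff_velocity ⟨ht₀0.le, ht₀I.2⟩).continuous
      ((hC t₀ ⟨ht₀0.le, le_rfl⟩).trans_lt hCt)
  rw [hslice] at h2
  -- enstrophy of the slice (Tao class, fact-free)
  obtain ⟨C₁, hC₁⟩ := D.hasBoundedSobolevNormsOn hν ht₀0 ht₀I.2 1
  have hD : ∫⁻ x, ‖iteratedFDeriv ℝ 1 (selfSimilarCollapse γ D.T U t₀) x‖ₑ ^ 2 < ⊤ := by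
    rw [← hslice]
    exact (hC₁ t₀ ⟨ht₀0.le, le_rfl⟩).trans_lt ENNReal.coe_lt_top
  exact ⟨memLp_two_profile_of_selfSimilarCollapse ht₀I.2 hUc h2,
    memLp_two_curl_profile_of_selfSimilarCollapse ht₀I.2 (hU.of_le (by norm_cast)) hD⟩

/-- **THEOREM (`ν > 0`, no integrability hypothesis). A designed forced blow-up is never an exact
collapse ansatz near its blow-up time.** Let `D : DesignedBlowup ν`, `ν > 0`, `γ ≠ ½`, `γ > −½`, and
suppose `D.u = selfSimilarCollapse γ D.T U` on `(t₁, T) × ℝ³` (`0 ≤ t₁ < T`) for a divergence-free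
`C³` profile `U`. Then `U ≡ 0`, the velocity vanishes on `(t₁, T) × ℝ³`, and `D.u` is NOT unbounded on
`[0, T) × K` for any compact `K`. FACT-FREE. [cite: FeffermanClay2006, (C) (5)]
[cite: ConstantinIgnatovaVicol2026Putative, §3.1] -/
theorem not_unboundedOn_of_eq_selfSimilarCollapse_of_pos (hν : 0 < ν) (hγ : γ ≠ 1 / 2)
    (hγ' : -(1 / 2) < γ) (ht₁ : 0 ≤ t₁) (ht₁T : t₁ < D.T) (hU : ContDiff ℝ 3 U)
    (hdiv : VectorCalculus.IsDivFree U)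
    (heq : ∀ t ∈ Ioo t₁ D.T, ∀ x, D.u t x = selfSimilarCollapse γ D.T U t x)
    {K : Set (EuclideanSpace ℝ (Fin 3))} (hK : IsCompact K) :
    ¬ ∀ M : ℝ, ∃ t ∈ Ico 0 D.T, ∃ x ∈ K, M < ‖D.u t x‖ := by
  obtain ⟨hU2, hω2⟩ := D.memLp_two_profile_and_curl_of_eq_selfSimilarCollapse hν ht₁ ht₁T hU heq
  exact D.not_unboundedOn_of_eq_selfSimilarCollapse hν.ne' hγ hγ' ht₁ ht₁T hU hdiv heq (p := 2)
    (by norm_num) ENNReal.ofNat_ne_top hω2 (r := 2) (by norm_num) ENNReal.ofNat_ne_top hU2 hK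

/-- **The profile is trivial (`ν > 0`, no integrability hypothesis).** [cite: FeffermanClay2006, (C) (5)] -/
theorem profile_eq_zero_of_eq_selfSimilarCollapse_of_pos (hν : 0 < ν) (hγ : γ ≠ 1 / 2)
    (hγ' : -(1 / 2) < γ) (ht₁ : 0 ≤ t₁) (ht₁T : t₁ < D.T) (hU : ContDiff ℝ 3 U)
    (hdiv : VectorCalculus.IsDivFree U)
    (heq : ∀ t ∈ Ioo t₁ D.T, ∀ x, D.u t x = selfSimilarCollapse γ D.T U t x) : U = 0 := by
  obtain ⟨hU2, hω2⟩ := D.memLp_two_profile_and_curl_of_eq_selfSimilarCollapse hν ht₁ ht₁T hU heq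
  exact D.profile_eq_zero_of_eq_selfSimilarCollapse hν.ne' hγ hγ' ht₁ ht₁T hU hdiv heq (p := 2)
    (by norm_num) ENNReal.ofNat_ne_top hω2 (r := 2) (by norm_num) ENNReal.ofNat_ne_top hU2

end DesignedBlowup

end Summit.NavierStokesRegularity.FluidComputer

end
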